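import Summits.ABC.StewartYu.PadicG3SchedB
import Summits.ABC.StewartYu.PadicG3ParVF
import HarnessLib

/-!
# Cell abc-stewartyu, crux `Y07Odd` (stmt-ABC-19658), `m = 0` branch: schedule arithmetic of the record schedule `P.schedVb b`
# for the inequality stub (`stub_ineqsV`)

`Summits/ABC/StewartYu/PadicG3VbSched.lean` — cell `abc-stewartyu` (seat p3-g7).  Theorems only, no named fact.  For the
`m = 0` record schedule `Sc := P.schedVb b` (`PadicG3SchedB`; fields `XsV, TV, MordV, L0V, HV, SdG`, box scale `LV/b`,
`b ≥ 1`) the sizes every family of the inequality pack needs, in the currency of p1's `PadicG3ParV*`: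
* orders: `TV 0 = 8 LgV`, `TV`/`RV` antitone, `RV 1 ≤ 8 LgV + ŜG`, `MordV s ν ≤ MordV 0 0`, `TordS Sc lev ν ≤ TordS Sc 0 0 ≤ (69/4)(n+1)LgV`,
  and the half-step order budget `TordS Sc lev n − tS Sc lev ≤ MV/(n+2)³ + (n+1)(RV 1 + ŜG) ≤ ((17n+21)/2)·LgV`;
* box: `sideS₂ Sc j ≤ LV/(2Aⱼ)`, `Lb (sideS₂ Sc) lev j ≤ LV/(2^lev Aⱼ)`, `Σⱼ Lb·Aⱼ ≤ n LV/2^lev`, `Σⱼ Lb ≤ n LV/2^lev` (`Aⱼ ≥ 1`);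
* nodes: `NS Sc lev ν = 2^ν XsV lev ≤ 2^ν (2^lev g XV/2 + 1)`, `tS Sc lev = TV lev + 1`.

References: Yu. V. Nesterenko, LNM 1819 (2003) (4.3)–(4.5); K. Yu, Acta Math. 211 (2013) §3.1.
-/

noncomputable section

open Finset
open Literature.NumberTheory.Transcendental

namespace Summit.ABC.StewartYu

namespace PadicG3Par

variable {n : ℕ} (P : PadicG3Par n)

/-- `TV 0 = 8·LgV`. [folklore] -/
theorem TV_zero : P.TV 0 = 8 * P.LgV := by
  unfold TV
  rw [pow_zero, Nat.div_one]
  have h : 1 ≤ P.LgV := le_trans Nat.one_le_two_pow P.two_pow_le_LgV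
  exact max_eq_right (by omega)

/-- `TV` is antitone in the level. [folklore] -/
theorem TV_mono {s s' : ℕ} (h : s ≤ s') : P.TV s' ≤ P.TV s := by
  unfold TV
  exact max_le_max le_rfl (Nat.div_le_div_left (Nat.pow_le_pow_right (by norm_num) h) (by positivity))

/-- `RV` is antitone in the level. [folklore] -/
theorem RV_mono {s s' : ℕ} (h : s ≤ s') : P.RV s' ≤ P.RV s := by
  unfold RV
  exact Finset.sum_le_sum_of_subset (Finset.Icc_subset_Icc h le_rfl)

/-- `RV 1 ≤ 8 LgV + ŜG` (geometric part `Σ_{s ≥ 1} 8LgV/2^s ≤ 8 LgV`, floor part `≤ ŜG`). [folklore] -/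
theorem RV_one_le : P.RV 1 ≤ 8 * P.LgV + P.SdG := by
  unfold RV TV
  have h1 : ∀ s ∈ Finset.Icc 1 P.SdG, max 1 (8 * P.LgV / 2 ^ s) ≤ 1 + 8 * P.LgV / 2 ^ s := by
    intro s _; exact max_le (Nat.le_add_right 1 _) (Nat.le_add_left _ _)
  refine (Finset.sum_le_sum h1).trans ?_
  rw [Finset.sum_add_distrib, Finset.sum_const, Nat.card_Icc, smul_eq_mul, mul_one]
  have h2 : ∑ s ∈ Finset.Icc 1 P.SdG, 8 * P.LgV / 2 ^ s ≤ 8 * P.LgV := by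
    have hreal : ((∑ s ∈ Finset.Icc 1 P.SdG, 8 * P.LgV / 2 ^ s : ℕ) : ℝ) ≤ 8 * P.LgV := by
      rw [Nat.cast_sum]
      have hL : (0 : ℝ) ≤ P.LgV := by positivity
      have hterm : ∀ s ∈ Finset.Icc 1 P.SdG, ((8 * P.LgV / 2 ^ s : ℕ) : ℝ) ≤ (4 * (P.LgV : ℝ)) * (1 / 2) ^ (s - 1) := by
        intro s hs
        rw [Finset.mem_Icc] at hs
        have hs2 : (2 : ℝ) ^ s = 2 * 2 ^ (s - 1) := by
          rw [← pow_succ']; congr 1; omega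
        calc ((8 * P.LgV / 2 ^ s : ℕ) : ℝ) ≤ ((8 * P.LgV : ℕ) : ℝ) / ((2 ^ s : ℕ) : ℝ) := Nat.cast_div_le
          _ = (4 * (P.LgV : ℝ)) * (1 / 2) ^ (s - 1) := by
              push_cast; rw [hs2, one_div, inv_pow]; field_simp; ring
      have hgeo : ∑ s ∈ Finset.Icc 1 P.SdG, (1 / 2 : ℝ) ^ (s - 1) ≤ 2 := by
        rw [← Finset.Ico_succ_right_eq_Icc, Order.succ_eq_add_one, Finset.sum_Ico_eq_sum_range]
        simp only [Nat.add_sub_cancel_left, Nat.add_sub_cancel]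
        exact sum_geometric_two_le _
      calc ∑ s ∈ Finset.Icc 1 P.SdG, ((8 * P.LgV / 2 ^ s : ℕ) : ℝ)
          ≤ ∑ s ∈ Finset.Icc 1 P.SdG, (4 * (P.LgV : ℝ)) * (1 / 2) ^ (s - 1) := Finset.sum_le_sum hterm
        _ = (4 * (P.LgV : ℝ)) * ∑ s ∈ Finset.Icc 1 P.SdG, (1 / 2 : ℝ) ^ (s - 1) := by rw [Finset.mul_sum]
        _ ≤ (4 * (P.LgV : ℝ)) * 2 := mul_le_mul_of_nonneg_left hgeo (by positivity)
        _ = 8 * P.LgV := by ring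
    exact_mod_cast hreal
  omega

/-- `MordV s ν ≤ MordV 0 0` (orders only decrease along the schedule). [folklore] -/
theorem MordV_le_zero_zero (s ν : ℕ) : P.MordV s ν ≤ P.MordV 0 0 := by
  unfold MordV
  have h1 : P.RV (s + 1) ≤ P.RV (0 + 1) := P.RV_mono (by omega)
  have h2 : P.TV s ≤ P.TV 0 := P.TV_mono (Nat.zero_le _)
  have h3 : n + 1 - ν ≤ n + 1 - 0 := Nat.sub_le_sub_left (Nat.zero_le _) _
  gcongr

/-- `MordV s n = MV/(n+2)³ + (n+1)·RV (s+1) + TV s`. [folklore] -/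
theorem MordV_at_n (s : ℕ) : P.MordV s n = P.MV / (n + 2) ^ 3 + (n + 1) * P.RV (s + 1) + P.TV s := by
  unfold MordV
  rw [show n + 1 - n = 1 by omega, one_mul]

/-- `MV/(n+2)³ ≤ 2·LgV` (`16(n+1) ≤ 2(n+2)³`). [folklore] -/
theorem MV_div_le : P.MV / (n + 2) ^ 3 ≤ 2 * P.LgV := by
  rw [P.MV_eq]
  calc 16 * (n + 1) * P.LgV / (n + 2) ^ 3 ≤ 2 * (n + 2) ^ 3 * P.LgV / (n + 2) ^ 3 := by
        refine Nat.div_le_div_right (Nat.mul_le_mul_right _ ?_)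
        have : 16 * (n + 1) ≤ 2 * (n + 2) ^ 3 := by ring_nf; nlinarith [Nat.zero_le n, sq_nonneg n]
        exact this
    _ = 2 * P.LgV := by
        rw [mul_comm 2 ((n+2)^3), mul_assoc, Nat.mul_div_cancel_left _ (by positivity)]

/-- **The half-step order budget** (ℝ): `MV/(n+2)³ + (n+1)(RV 1 + ŜG) ≤ ((17n+21)/2)·LgV` (as `RV 1 ≤ 8LgV + ŜG`, `4(ŜG+2) ≤ LgV`). [folklore] -/
theorem halfOrders_real_le : ((P.MV / (n + 2) ^ 3 + (n + 1) * (P.RV 1 + P.SdG) : ℕ) : ℝ) ≤ (17 * n + 21) / 2 * P.LgV := by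
  have h1 : ((P.MV / (n + 2) ^ 3 : ℕ) : ℝ) ≤ 2 * P.LgV := by exact_mod_cast P.MV_div_le
  have h2 : ((P.RV 1 : ℕ) : ℝ) ≤ 8 * P.LgV + P.SdG := by exact_mod_cast P.RV_one_le
  have h4 : ((4 * (P.SdG + 2) : ℕ) : ℝ) ≤ P.LgV := by exact_mod_cast P.four_SdG_le_LgV
  push_cast at h4 ⊢
  have hn : (0 : ℝ) ≤ n := by positivity
  have hS : (0 : ℝ) ≤ P.SdG := by positivity
  nlinarith [mul_le_mul_of_nonneg_left h2 (by positivity : (0:ℝ) ≤ (n:ℝ) + 1)]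

/-- `MordV 0 0 + ŜG(n+1) + n ≤ (69/4)(n+1)·LgV` (real; the level-0 START order in p2's `TordS` form). [folklore] -/
theorem startOrders_real_le : (P.MordV 0 0 : ℝ) + P.SdG * (n + 1) + n ≤ (69 / 4) * (n + 1) * P.LgV := by
  have h := P.MordV_T0_le
  have hS : (0 : ℝ) ≤ P.SdG := by positivity
  nlinarith

end PadicG3Par

namespace G3Setup

variable {p : ℕ} [Fact p.Prime] (S : G3Setup p) (P : PadicG3Par S.n) (b : ℝ)

/-! ### The schedule `P.schedVb b` through p2's derived quantities -/

/-- `NS (schedVb b) lev ν = 2^ν · XsV lev`. [folklore] -/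
theorem NS_Vb (lev ν : ℕ) : S.NS (P.schedVb b) lev ν = 2 ^ ν * P.XsV lev := rfl

/-- `NhS (schedVb b) lev = XsV lev`. [folklore] -/
theorem NhS_Vb (lev : ℕ) : S.NhS (P.schedVb b) lev = P.XsV lev := rfl

/-- `tS (schedVb b) lev = TV lev + 1`. [folklore] -/
theorem tS_Vb (lev : ℕ) : S.tS (P.schedVb b) lev = P.TV lev + 1 := rfl

/-- `TordS (schedVb b) lev ν = MordV lev ν + (ŜG − lev)(n+1) + (n − ν)`. [folklore] -/
theorem TordS_Vb (lev ν : ℕ) : S.TordS (P.schedVb b) lev ν = P.MordV lev ν + ((P.SdG - lev) * (S.n + 1) + (S.n - ν)) := rfl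

/-- `NS (schedVb b) lev ν ≤ 2^ν (2^lev g XV/2 + 1)` (real). [folklore] -/
theorem NS_Vb_real_le (lev ν : ℕ) : (S.NS (P.schedVb b) lev ν : ℝ) ≤ 2 ^ ν * (2 ^ lev * P.g * P.XV / 2 + 1) := by
  rw [S.NS_Vb P b]
  push_cast
  exact mul_le_mul_of_nonneg_left (P.XsV_le lev) (by positivity)

/-- **`TordS lev ν ≤ TordS 0 0`** along the schedule. [folklore] -/
theorem TordS_Vb_le_zero (lev ν : ℕ) : S.TordS (P.schedVb b) lev ν ≤ S.TordS (P.schedVb b) 0 0 := by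
  rw [S.TordS_Vb P b, S.TordS_Vb P b]
  have h1 := P.MordV_le_zero_zero lev ν
  have h2 : (P.SdG - lev) * (S.n + 1) ≤ (P.SdG - 0) * (S.n + 1) := Nat.mul_le_mul_right _ (Nat.sub_le_sub_left (Nat.zero_le _) _)
  have h3 : S.n - ν ≤ S.n - 0 := Nat.sub_le_sub_left (Nat.zero_le _) _
  omega

/-- **`TordS 0 0 ≤ (69/4)(n+1)·LgV`** (real). [folklore] -/
theorem TordS_Vb_zero_real_le : (S.TordS (P.schedVb b) 0 0 : ℝ) ≤ (69 / 4) * (S.n + 1) * P.LgV := by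
  rw [S.TordS_Vb P b]
  have h := P.startOrders_real_le
  simp only [Nat.sub_zero]
  push_cast
  nlinarith [h]

/-- **The half-step order budget**: `TordS lev n − tS lev ≤ MV/(n+2)³ + (n+1)(RV 1 + ŜG)` for `lev ≤ ŜG`. [folklore] -/
theorem TordS_Vb_half_sub_le (lev : ℕ) :
    S.TordS (P.schedVb b) lev S.n - S.tS (P.schedVb b) lev ≤ P.MV / (S.n + 2) ^ 3 + (S.n + 1) * (P.RV 1 + P.SdG) := by
  rw [S.TordS_Vb P b, S.tS_Vb P b, P.MordV_at_n]
  simp only [Nat.sub_self, add_zero]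
  have h1 : P.RV (lev + 1) ≤ P.RV 1 := P.RV_mono (by omega)
  have h2 : (P.SdG - lev) * (S.n + 1) ≤ (S.n + 1) * P.SdG := by rw [mul_comm]; exact Nat.mul_le_mul_left _ (Nat.sub_le _ _)
  have h3 : (S.n + 1) * P.RV (lev + 1) ≤ (S.n + 1) * P.RV 1 := Nat.mul_le_mul_left _ h1
  have e : (S.n + 1) * (P.RV 1 + P.SdG) = (S.n + 1) * P.RV 1 + (S.n + 1) * P.SdG := mul_add _ _ _
  apply tsub_le_iff_right.mpr
  linarith

/-- The half-step order budget, real: `≤ ((17n+21)/2)·LgV`. [folklore] -/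
theorem TordS_Vb_half_sub_real_le (lev : ℕ) :
    ((S.TordS (P.schedVb b) lev S.n - S.tS (P.schedVb b) lev : ℕ) : ℝ) ≤ (17 * S.n + 21) / 2 * P.LgV :=
  le_trans (by exact_mod_cast S.TordS_Vb_half_sub_le P b lev) P.halfOrders_real_le

/-! ### The box -/

/-- `sideS₂ (schedVb b) j ≤ LV/(2 Aⱼ)` for `b ≥ 1`. [folklore] -/
theorem sideS₂_Vb_le (hb : 1 ≤ b) (j : Fin S.n) : (S.sideS₂ (P.schedVb b) j : ℝ) ≤ P.LV / (2 * P.A j) := by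
  unfold sideS₂
  rw [P.schedVb_Lbox, P.schedVb_A]
  have hA := P.A_pos j
  have hL : (0 : ℝ) ≤ P.LV := by positivity
  refine (Nat.floor_le (by positivity)).trans ?_
  rw [div_div]
  exact div_le_div_of_nonneg_left hL (by positivity) (by nlinarith)

/-- **`Lb (sideS₂ (schedVb b)) lev j ≤ LV/(2^lev Aⱼ)`** for `b ≥ 1`. [folklore] -/
theorem Lb_Vb_le (hb : 1 ≤ b) (lev : ℕ) (j : Fin S.n) :
    (S.Lb (S.sideS₂ (P.schedVb b)) lev j : ℝ) ≤ P.LV / (2 ^ lev * P.A j) := by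
  have h1 := S.Lb_le_real (S.sideS₂ (P.schedVb b)) lev j
  have h2 := S.sideS₂_Vb_le P b hb j
  have hA := P.A_pos j
  have h2' : 2 * (S.sideS₂ (P.schedVb b) j : ℝ) / (2 : ℝ) ^ lev ≤ 2 * (P.LV / (2 * P.A j)) / (2 : ℝ) ^ lev := by
    gcongr
  refine h1.trans (h2'.trans (le_of_eq ?_))
  field_simp

/-- `Σⱼ Lb·Aⱼ ≤ n·LV/2^lev`. [folklore] -/
theorem sum_Lb_mul_A_Vb_le (hb : 1 ≤ b) (lev : ℕ) :
    ∑ j, (S.Lb (S.sideS₂ (P.schedVb b)) lev j : ℝ) * P.A j ≤ S.n * P.LV / 2 ^ lev := by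
  have h : ∀ j ∈ (Finset.univ : Finset (Fin S.n)), (S.Lb (S.sideS₂ (P.schedVb b)) lev j : ℝ) * P.A j ≤ P.LV / 2 ^ lev := by
    intro j _
    have h1 := S.Lb_Vb_le P b hb lev j
    have hA := P.A_pos j
    calc (S.Lb (S.sideS₂ (P.schedVb b)) lev j : ℝ) * P.A j ≤ P.LV / (2 ^ lev * P.A j) * P.A j :=
          mul_le_mul_of_nonneg_right h1 hA.le
      _ = P.LV / 2 ^ lev := by field_simp
  calc ∑ j, (S.Lb (S.sideS₂ (P.schedVb b)) lev j : ℝ) * P.A j ≤ ∑ _j : Fin S.n, (P.LV : ℝ) / 2 ^ lev := Finset.sum_le_sum h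
    _ = S.n * P.LV / 2 ^ lev := by rw [Finset.sum_const, Finset.card_univ, Fintype.card_fin, nsmul_eq_mul]; ring

/-- `Σⱼ Lb ≤ n·LV/2^lev` when every `Aⱼ ≥ 1`. [folklore] -/
theorem sum_Lb_Vb_le (hb : 1 ≤ b) (hA1 : ∀ j, 1 ≤ P.A j) (lev : ℕ) :
    ∑ j, (S.Lb (S.sideS₂ (P.schedVb b)) lev j : ℝ) ≤ S.n * P.LV / 2 ^ lev := by
  refine le_trans (Finset.sum_le_sum fun j _ => ?_) (S.sum_Lb_mul_A_Vb_le P b hb lev)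
  have h0 : (0 : ℝ) ≤ (S.Lb (S.sideS₂ (P.schedVb b)) lev j : ℝ) := by positivity
  nlinarith [hA1 j]

end G3Setup

end Summit.ABC.StewartYu

end
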